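import Summits.CriticalPhenomena.PercolationContinuityZ3.Theses.PercFiniteBoxLRO
import Literature.Probability.Percolation.ContinuityCriterion

/-!
# Crux `PercFiniteBoxLRO.RenormaliseFromLinearLRO` (stmt-CriticalPhenomena-0857), line `registered` —
# anatomy of the crux: `R ↔ ¬LRO_lin(p_c)` (registered sub-goal `stub_cruxIffNotLinearLROAtPc`)

The crux R says: for every `p ∈ [0,1]`, linear-scale finite-box long-range order at `p`
(`LRO_lin(p) := ∃ ρ > 0, ∃ K, ∀ n ≥ 1, ∀ x y ∈ Λ(n), ρ ≤ P_p(x ↔ y inside Λ(Kn))`) forces percolation at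
some `p' < p`.  This file proves, by elementary means, the refuters' reading of the item (notes g28-0/1/5/6
and rreview1 on stmt-0857): **R is EQUIVALENT to the absence of linear-scale finite-box LRO at the critical
point**, `R ↔ ¬LRO_lin(p_c(ℤ³))`, because

* `le_theta_of_linearLRO`: `LRO_lin(p) ⇒ θ(p) ≥ ρ > 0` (the open path `0 ↔ (n+1)e₀` inside `Λ(K(n+1))`
  leaves `Λ(n)` through its inner boundary, so `P_p(0 ↔ ∂Λ(n)) ≥ ρ` for all `n`, and these decrease to
  `θ(p)`), hence `LRO_lin(p) ⇒ p ≥ p_c` (`θ ≡ 0` below `p_c`);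
* `exists_lt_theta_pos_of_criticalProb_lt`: for `p > p_c` the conclusion of R is the DEFINITION of `p_c`
  (`p_c = inf ({q | θ(q) > 0} ∪ {1})`; no θ-monotonicity needed);
* so the only parameter at which R says anything is `p = p_c`, where its conclusion (`θ(p') > 0` for some
  `p' < p_c`) is false; i.e. R holds iff its hypothesis fails at `p_c`.

Consequently every proof of R is a proof of `¬LRO_lin(p_c)` (a statement implied by, and in the presence of
Cerf's missing estimate `X_D = LinearScaleLROOfTheta` equivalent to, `θ(p_c) = 0`), and the line's one open
stub `stub_critBoost` (boost at `p_c`) is equivalent to R.  No percolation estimate beyond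
`θ(p) ≤ P_p(0 ↔ ∂Λ(n))` is used here.

Lands `--supports stmt-CriticalPhenomena-0857` (registered sub-goal `stub_cruxIffNotLinearLROAtPc`).
-/

noncomputable section

namespace Summit.CriticalPhenomena.PercolationContinuityZ3.Theorems.RenormaliseFromLinearLRO

open Literature.Probability.Percolation Literature.Probability.LatticeModels
open MeasureTheory

/-- **Linear-scale finite-box LRO forces percolation**: if `P_p(x ↔ y inside Λ(Kn)) ≥ ρ` for all
`n ≥ 1` and all `x, y ∈ Λ(n)`, then `ρ ≤ θ(p)`.  The open path `0 ↔ (n+1)e₀` (a pair of `Λ(n+1)`) leaves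
`Λ(n)` through its inner vertex boundary, so `P_p(0 ↔ ∂Λ(n)) ≥ τ_p(0,(n+1)e₀) ≥ ρ` for every `n`
(`tau_le_real_siteToBoundary`), and `P_p(0 ↔ ∂Λ(n)) ↓ θ(p)` (continuity from above,
`DCT16.le_theta_of_forall_le_real_siteToBoundary`). -/
theorem le_theta_of_linearLRO (p : unitInterval) {ρ : ℝ} {K : ℕ}
    (h : ∀ n : ℕ, 1 ≤ n → ∀ x ∈ box 3 n, ∀ y ∈ box 3 n,
      ρ ≤ (bondPercolation (zdGraph 3) p).real (openConnIn ↑(box 3 (K * n)) x y)) :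
    ρ ≤ theta (zdGraph 3) 0 p := by
  refine DCT16.le_theta_of_forall_le_real_siteToBoundary p fun n => ?_
  set y : Site 3 := Pi.single 0 ((n : ℤ) + 1) with hy
  have hy1 : y ∈ box 3 (n + 1) := by
    rw [mem_box]; intro i
    by_cases hi : i = 0
    · subst hi; simp [hy]; omega
    · simp [hy, Pi.single_eq_of_ne hi]; omega
  have hy0 : y ∉ box 3 n := by
    rw [mem_box]; intro hall
    have := (hall 0).2
    simp [hy] at this
  have h0 : (0 : Site 3) ∈ box 3 (n + 1) := zero_mem_box 3 (n + 1)
  calc ρ ≤ (bondPercolation (zdGraph 3) p).real (openConnIn ↑(box 3 (K * (n + 1))) 0 y) :=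
        h (n + 1) (Nat.succ_le_succ (Nat.zero_le n)) 0 h0 y hy1
    _ ≤ tau 3 p 0 y := by
        rw [tau_def]
        exact measureReal_mono (fun ω hω => DCT16.reachable_of_pathIn (DCT16.pathIn_of_mem_openConnIn hω))
    _ ≤ (bondPercolation (zdGraph 3) p).real (siteToBoundary 3 n) :=
        tau_le_real_siteToBoundary p hy0

/-- **Linear-scale finite-box LRO can only hold at or above `p_c`**: `LRO_lin(p) ⇒ p_c ≤ p`
(`le_theta_of_linearLRO` and `θ ≡ 0` below `p_c`). -/
theorem criticalProb_le_of_linearLRO (p : unitInterval)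
    (h : ∃ ρ : ℝ, 0 < ρ ∧ ∃ K : ℕ, ∀ n : ℕ, 1 ≤ n → ∀ x ∈ box 3 n, ∀ y ∈ box 3 n,
      ρ ≤ (bondPercolation (zdGraph 3) p).real (openConnIn ↑(box 3 (K * n)) x y)) :
    criticalProb (zdGraph 3) (0 : Site 3) ≤ p := by
  obtain ⟨ρ, hρ, K, hK⟩ := h
  have hθ : 0 < theta (zdGraph 3) 0 p := hρ.trans_le (le_theta_of_linearLRO p hK)
  by_contra hlt
  exact absurd (theta_eq_zero_of_lt_criticalProb_holds (zdGraph 3) (0 : Site 3) p (not_le.1 hlt))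
    (ne_of_gt hθ)

/-- **The supercritical case of R is the definition of `p_c`**: if `p_c < p` then `θ(p') > 0` for some
`p' < p` (`p_c = inf ({q | θ(q) > 0} ∪ {1})`, `exists_lt_of_csInf_lt`; no monotonicity of `θ` is used). -/
theorem exists_lt_theta_pos_of_criticalProb_lt (p : unitInterval)
    (hp : criticalProb (zdGraph 3) (0 : Site 3) < p) :
    ∃ q : unitInterval, q < p ∧ 0 < theta (zdGraph 3) 0 q := by
  obtain ⟨q, hq, hqp⟩ := exists_lt_of_csInf_lt
    (⟨1, Or.inr rfl⟩ : ({q : ℝ | ∃ h : q ∈ unitInterval, 0 < theta (zdGraph 3) (0 : Site 3) ⟨q, h⟩} ∪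
      {1}).Nonempty) hp
  rcases hq with ⟨hq01, hθ⟩ | hq1
  · exact ⟨⟨q, hq01⟩, hqp, hθ⟩
  · rw [Set.mem_singleton_iff] at hq1
    exact absurd (hq1 ▸ hqp) (not_lt.2 p.2.2)

/-- **`¬LRO_lin(p_c) ⇒ R`**: above `p_c` by the definition of `p_c`, and at or below `p_c` the hypothesis
`LRO_lin(p)` forces `p = p_c` (`criticalProb_le_of_linearLRO`), where it is excluded. -/
theorem renormaliseFromLinearLRO_of_not_linearLRO_criticalProbI
    (h : ¬ (∃ ρ : ℝ, 0 < ρ ∧ ∃ K : ℕ, ∀ n : ℕ, 1 ≤ n → ∀ x ∈ box 3 n, ∀ y ∈ box 3 n,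
      ρ ≤ (bondPercolation (zdGraph 3) (criticalProbI 3)).real (openConnIn ↑(box 3 (K * n)) x y))) :
    Summit.CriticalPhenomena.PercolationContinuityZ3.Theses.PercFiniteBoxLRO.RenormaliseFromLinearLRO := by
  intro p hLRO
  by_cases hsup : criticalProb (zdGraph 3) (0 : Site 3) < p
  · exact exists_lt_theta_pos_of_criticalProb_lt p hsup
  · exfalso
    have heq : p = criticalProbI 3 :=
      Subtype.ext (le_antisymm (not_lt.1 hsup) (criticalProb_le_of_linearLRO p hLRO))
    subst heq
    exact h hLRO

/-- **`R ⇒ ¬LRO_lin(p_c)`**: R at `p = p_c` would give `θ(p') > 0` at some `p' < p_c`, contradicting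
`θ ≡ 0` below `p_c`. -/
theorem not_linearLRO_criticalProbI_of_renormaliseFromLinearLRO
    (hR : Summit.CriticalPhenomena.PercolationContinuityZ3.Theses.PercFiniteBoxLRO.RenormaliseFromLinearLRO) :
    ¬ (∃ ρ : ℝ, 0 < ρ ∧ ∃ K : ℕ, ∀ n : ℕ, 1 ≤ n → ∀ x ∈ box 3 n, ∀ y ∈ box 3 n,
      ρ ≤ (bondPercolation (zdGraph 3) (criticalProbI 3)).real (openConnIn ↑(box 3 (K * n)) x y)) := by
  intro hLRO
  obtain ⟨p', hp', hθ⟩ := hR (criticalProbI 3) hLRO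
  exact absurd (theta_eq_zero_of_lt_criticalProb_holds (zdGraph 3) (0 : Site 3) p' hp') (ne_of_gt hθ)

/-- **Registered sub-goal `stub_cruxIffNotLinearLROAtPc` of crux stmt-CriticalPhenomena-0857 (line
`registered`) — the anatomy of the crux, kernel-checked**: `RenormaliseFromLinearLRO` holds if and only if
there is NO linear-scale finite-box long-range order at `p_c(ℤ³)`, i.e. iff
`¬ ∃ ρ > 0, ∃ K, ∀ n ≥ 1, ∀ x y ∈ Λ(n), ρ ≤ P_{p_c}(x ↔ y inside Λ(Kn))`.  Elementary (definition of `p_c`,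
`θ ≡ 0` below `p_c`, `θ(p) ≤ P_p(0 ↔ ∂Λ(n))`); the whole difficulty of the item is its critical case. -/
theorem stub_cruxIffNotLinearLROAtPc :
    Summit.CriticalPhenomena.PercolationContinuityZ3.Theses.PercFiniteBoxLRO.RenormaliseFromLinearLRO ↔
      ¬ (∃ ρ : ℝ, 0 < ρ ∧ ∃ K : ℕ, ∀ n : ℕ, 1 ≤ n → ∀ x ∈ box 3 n, ∀ y ∈ box 3 n,
          ρ ≤ (bondPercolation (zdGraph 3) (criticalProbI 3)).real (openConnIn ↑(box 3 (K * n)) x y)) :=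
  ⟨not_linearLRO_criticalProbI_of_renormaliseFromLinearLRO, renormaliseFromLinearLRO_of_not_linearLRO_criticalProbI⟩

end Summit.CriticalPhenomena.PercolationContinuityZ3.Theorems.RenormaliseFromLinearLRO

end
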